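import Summits.ValiantsHypothesis.ValiantsHypothesis.Theorems.BorderApolarityFixedWitnessObstructionQPOrderChain
import Literature.Combinatorics.Optimization.EgervaryDuality
import Literature.Computability.AlgebraicComplexity.PaddedPowerSums
import Mathlib.LinearAlgebra.Matrix.Permutation

/-!
# Border apolarity, crux `FixedWitnessObstructionQP` — homogeneous frames de-border for free

Route `ValiantsHypothesis/BorderApolarity`, crux item `stmt-ValiantsHypothesis-5778`, line `toric-face-debordering`
(parallel continuation seat c3; helper `--supports` with the registered stub `stub_homogeneousFrame`; nothing of the lead
seat -2's skeleton is restated).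

The line's one open stub `ToricDeborderQP` asks that an EXTREMAL toric representation
`pp_{n,m} = u · wHC_w^e (g · det_m)` (`⟨w, d⟩ ≤ e` on `supp (g · det_m)`) force `dc(per_n) ≤ 2^polylog(m)`.  Seat -2 reduced
it to Murota's potential gap (`…QPOrderChain.lean`, `…QPOrderInstance.lean`): feasible Egerváry potentials `p, q` give
`dc(per_n) ≤ 3((m+1)(Σp + Σq − e + 1))^10` (`stub_dcLeOfPotentialRep`, under `e ≤ Σp + Σq`), and a TIGHT frame
(`Σp + Σq = e`) gives `dc(per_n) ≤ m` (`hasDetRepr_of_tight_potentials`); the calibration `…QPTightDet.lean` shows `g = 1`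
(the torus-orbit closure of `det_m` itself) is always tight.  This file adds, over the landed Egerváry duality
(`Literature/Combinatorics/Optimization/EgervaryDuality.lean`) and the frame change `stub_deborderFrame`:

* `weightedHomogeneousComponent_det_eq_det_tight` — the slice AT `Σp + Σq` is the determinant of the TIGHT matrix
  `(wHC_w^{p_a + q_b} L_ab)_ab` (gap `0` of the frame change; = the lead's `det_tightLayer_eq_weightedHomogeneousComponent`);
* `weightedHomogeneousComponent_det_eq_zero_of_lt`, `le_sum_potentials_of_slice_ne_zero` — above `Σp + Σq` every slice of
  `det L` vanishes, so FEASIBLE potentials automatically satisfy `e ≤ Σp + Σq` for every nonzero slice (this discharges the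
  order hypothesis of `stub_dcLeOfPotentialRep` for every representation of the padded permanent, which is nonzero);
* `sum_potentials_eq_of_det_tight_ne_zero`, `hasDetRepr_slice_of_det_tight_ne_zero`,
  `linSubst_slice_mem_endOrbit_of_det_tight_ne_zero` (per/det-blind) and
  `sum_potentials_eq_and_hasDetRepr_of_det_tight_ne_zero` — if the tight matrix of `g · x` is NONSINGULAR (branch (T) of the
  tight/fooling dichotomy, for an arbitrary square frame `g`), a nonzero extremal slice has `e = Σp + Σq`, lies (with all
  its translates) in `End · det_m` and de-borders at size `m`; for the padded permanent, `dc(per_n) ≤ m`;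
* `det_tight_ne_zero_of_isWeightedHomogeneous` — if every entry `g · x_ab` is `w`-homogeneous (weight `ν a b`) and `g` is
  invertible, the Egerváry-tight matrix of `ν` is nonsingular (evaluate at the `g`-preimage of the tight permutation
  matrix: the entries of `g · x` are linearly independent forms) — the first class of frames BEYOND `g = 1` proved tight;
* `linSubst_initialForm_mem_endOrbit_of_homogeneousFrame` — GEOMETRIC THEOREM (per/det-blind): in a homogeneous-entry frame
  every nonzero extremal initial form `u · in_w(g · det_m)` lies in `End · det_m` (frame-compatible tori never reach
  `Δ(det_m) ∖ End · det_m`);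
* `hasDetRepr_perPoly_of_homogeneousFrame`, `determinantalComplexity_perPoly_le_of_homogeneousFrame`, registered stub
  `stub_homogeneousFrame` — THEOREM: an extremal toric representation of the padded permanent at size `m` in a
  HOMOGENEOUS-ENTRY frame forces `dc(per_n) ≤ m`; `determinantalComplexity_perPoly_le_of_monomialFrame` — in particular for
  every monomial frame `g = P · diag(c)` (tori normalised by the matrix frame).

Consequence for the line (numbers, not adjectives): homogeneous-entry frames — every torus normalised by the matrix frame,
in particular every monomial `g` — can NEVER undercut `dc(per_n)`; an extremal toric representation of a padded permanent at
size `m < dc(per_n)` must have an entry of `g · x` mixing two `w`-weights, which is exactly where Murota's cancellation gap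
(`PotentialGapQP`) lives.  Everything here is per/det-blind except the final unpadding.
-/

open scoped BigOperators Matrix Polynomial
open Literature.Computability.AlgebraicComplexity

namespace Summit.ValiantsHypothesis.ValiantsHypothesis.Theorems.BorderApolarityFixedWitnessObstructionQP

set_option linter.dupNamespace false

/-- **Above the potential bound the slices vanish.**  If `wHC_w^j (L_ab) = 0` for `j > p_a + q_b` (FEASIBLE potentials)
then `wHC_w^e (det L) = 0` for every `e > Σp + Σq`: the layered family has entry degrees `≤ p_a + q_b`, so its determinant
has degree `≤ Σp + Σq`. [folklore] -/
theorem weightedHomogeneousComponent_det_eq_zero_of_lt {σ : Type*} [Fintype σ] [DecidableEq σ]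
    {ι : Type*} [Fintype ι] [DecidableEq ι] (L : Matrix ι ι (MvPolynomial σ ℂ))
    (hL : ∀ a b, (L a b).IsHomogeneous 1) (w : σ → ℕ) (p q : ι → ℕ)
    (hfeas : ∀ a b j, p a + q b < j → MvPolynomial.weightedHomogeneousComponent w j (L a b) = 0)
    {e : ℕ} (he : ∑ a, p a + ∑ b, q b < e) :
    MvPolynomial.weightedHomogeneousComponent w e L.det = 0 := by
  rw [weightedHomogeneousComponent_det_eq_coeff L hL w e]
  set M : Matrix ι ι (Polynomial (MvPolynomial σ ℂ)) := Matrix.of fun a b =>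
    ∑ j ∈ Finset.range (e + 1), Polynomial.monomial j (MvPolynomial.weightedHomogeneousComponent w j (L a b))
    with hM
  have hent : ∀ a b, (M a b).natDegree ≤ p a + q b := by
    intro a b
    simp only [hM, Matrix.of_apply]
    refine Polynomial.natDegree_sum_le_of_forall_le _ _ fun j _ => ?_
    by_cases hjle : j ≤ p a + q b
    · exact (Polynomial.natDegree_monomial_le _).trans hjle
    · rw [hfeas a b j (lt_of_not_ge hjle), map_zero, Polynomial.natDegree_zero]
      exact Nat.zero_le _
  apply Polynomial.coeff_eq_zero_of_natDegree_lt
  refine lt_of_le_of_lt ?_ he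
  rw [Matrix.det_apply]
  refine Polynomial.natDegree_sum_le_of_forall_le _ _ fun τ _ => ?_
  calc (Equiv.Perm.sign τ • ∏ i, M (τ i) i).natDegree ≤ (∏ i, M (τ i) i).natDegree := by
        rcases Int.units_eq_one_or (Equiv.Perm.sign τ) with sg | sg
        · rw [sg, one_smul]
        · rw [sg, Units.neg_smul, one_smul, Polynomial.natDegree_neg]
    _ ≤ ∑ i, (M (τ i) i).natDegree := Polynomial.natDegree_prod_le _ _
    _ ≤ ∑ i, (p (τ i) + q i) := Finset.sum_le_sum fun i _ => hent (τ i) i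
    _ = ∑ a, p a + ∑ b, q b := by rw [Finset.sum_add_distrib, Equiv.sum_comp τ p]

/-- **The slice at the potential bound is the tight determinant** (gap `0` of the frame change `stub_deborderFrame`):
with feasible potentials, `wHC_w^{Σp+Σq} (det L) = det (wHC_w^{p_a+q_b} L_ab)_ab`.  (The same identity, read right to left,
is `det_tightLayer_eq_weightedHomogeneousComponent` of the lead's concurrent `…QPTightDet.lean`; it is re-derived here in
three lines from `stub_deborderFrame` so that this file depends only on `…QPOrderChain.lean`.)
[cite: Murota1995CombinatorialRelaxation, §4] -/
theorem weightedHomogeneousComponent_det_eq_det_tight {σ : Type*} [Fintype σ] [DecidableEq σ]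
    {ι : Type*} [Fintype ι] [DecidableEq ι] (L : Matrix ι ι (MvPolynomial σ ℂ))
    (hL : ∀ a b, (L a b).IsHomogeneous 1) (w : σ → ℕ) (p q : ι → ℕ)
    (hfeas : ∀ a b j, p a + q b < j → MvPolynomial.weightedHomogeneousComponent w j (L a b) = 0) :
    MvPolynomial.weightedHomogeneousComponent w (∑ a, p a + ∑ b, q b) L.det =
      (Matrix.of fun a b => MvPolynomial.weightedHomogeneousComponent w (p a + q b) (L a b)).det := by
  have hframe := weightedHomogeneousComponent_det_eq_coeff_of_potentials L hL w _ p q hfeas le_rfl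
  rw [Nat.sub_self] at hframe
  rw [hframe]
  have hM : (Matrix.of fun a b => ∑ i ∈ Finset.range (0 + 1), Polynomial.monomial i
      (if i ≤ p a + q b then MvPolynomial.weightedHomogeneousComponent w (p a + q b - i) (L a b) else 0)) =
      (Polynomial.C : MvPolynomial σ ℂ →+* _).mapMatrix
        (Matrix.of fun a b => MvPolynomial.weightedHomogeneousComponent w (p a + q b) (L a b)) := by
    ext a b
    simp [Polynomial.monomial_zero_left]
  rw [hM, ← RingHom.map_det, Polynomial.coeff_C_zero]

/-- **Feasible potentials dominate every nonzero slice** (discharges the hypothesis `e ≤ Σp + Σq` of seat -2's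
registered `stub_dcLeOfPotentialRep` / of `PotentialGapQP` whenever the represented slice is nonzero, e.g. for every
representation of the padded permanent): if `wHC_w^j (g · x_ab) = 0` for `j > p_a + q_b` and `wHC_w^e (g · det_m) ≠ 0`
then `e ≤ Σp + Σq`. [folklore] -/
theorem le_sum_potentials_of_slice_ne_zero {m : ℕ}
    (g : Matrix (Fin m × Fin m) (Fin m × Fin m) ℂ) (w : Fin m × Fin m → ℕ) (e : ℕ) (p q : Fin m → ℕ)
    (hfeas : ∀ a b j, p a + q b < j →
      MvPolynomial.weightedHomogeneousComponent w j (linSubst (Fin m × Fin m) ℂ g (MvPolynomial.X (a, b))) = 0)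
    (hne : MvPolynomial.weightedHomogeneousComponent w e (linSubst (Fin m × Fin m) ℂ g (detPoly (Fin m) ℂ)) ≠ 0) :
    e ≤ ∑ a, p a + ∑ b, q b := by
  set L : Matrix (Fin m) (Fin m) (MvPolynomial (Fin m × Fin m) ℂ) :=
    (linSubst (Fin m × Fin m) ℂ g).toRingHom.mapMatrix (Matrix.mvPolynomialX (Fin m) (Fin m) ℂ) with hL
  have hLab : ∀ a b, L a b = linSubst (Fin m × Fin m) ℂ g (MvPolynomial.X (a, b)) := fun a b => by
    simp only [hL, RingHom.mapMatrix_apply, Matrix.map_apply, Matrix.mvPolynomialX_apply]; rfl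
  have hdet : linSubst (Fin m × Fin m) ℂ g (detPoly (Fin m) ℂ) = L.det := by
    rw [hL, detPoly, ← RingHom.map_det]; rfl
  have hlin : ∀ a b, (L a b).IsHomogeneous 1 := fun a b => by
    rw [hLab]; exact linSubst_isHomogeneous g (MvPolynomial.isHomogeneous_X ℂ (a, b))
  have hfeasL : ∀ a b j, p a + q b < j → MvPolynomial.weightedHomogeneousComponent w j (L a b) = 0 :=
    fun a b j hj => by rw [hLab]; exact hfeas a b j hj
  refine le_of_not_gt fun hlt => hne ?_
  rw [hdet]
  exact weightedHomogeneousComponent_det_eq_zero_of_lt L hlin w p q hfeasL hlt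

/-- **Nonsingular tight matrix ⇒ the frame is tight** (per/det-blind).  Let `p, q` be feasible potentials for the
entries of `g · x` (`wHC_w^j (g · x_ab) = 0` for `j > p_a + q_b`, any square `g`) and let `e` be an EXTREMAL level of
`g · det_m` (`⟨w, d⟩ ≤ e` on `supp (g · det_m)`) whose slice `wHC_w^e (g · det_m)` is nonzero.  If the tight matrix
`(wHC_w^{p_a+q_b} (g · x_ab))_ab` is nonsingular then `Σp + Σq = e`: extremality bounds `e` below by the weight `Σp + Σq`
of the (nonzero) tight slice, and the nonvanishing of the slice bounds it above (every slice above `Σp + Σq` is zero).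
[folklore] -/
theorem sum_potentials_eq_of_det_tight_ne_zero {m : ℕ}
    (g : Matrix (Fin m × Fin m) (Fin m × Fin m) ℂ) (w : Fin m × Fin m → ℕ) (e : ℕ) (p q : Fin m → ℕ)
    (hfeas : ∀ a b j, p a + q b < j →
      MvPolynomial.weightedHomogeneousComponent w j (linSubst (Fin m × Fin m) ℂ g (MvPolynomial.X (a, b))) = 0)
    (htight : (Matrix.of fun a b => MvPolynomial.weightedHomogeneousComponent w (p a + q b)
      (linSubst (Fin m × Fin m) ℂ g (MvPolynomial.X (a, b)))).det ≠ 0)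
    (hext : ∀ d ∈ (linSubst (Fin m × Fin m) ℂ g (detPoly (Fin m) ℂ)).support, Finsupp.weight w d ≤ e)
    (hne : MvPolynomial.weightedHomogeneousComponent w e (linSubst (Fin m × Fin m) ℂ g (detPoly (Fin m) ℂ)) ≠ 0) :
    ∑ a, p a + ∑ b, q b = e := by
  set L : Matrix (Fin m) (Fin m) (MvPolynomial (Fin m × Fin m) ℂ) :=
    (linSubst (Fin m × Fin m) ℂ g).toRingHom.mapMatrix (Matrix.mvPolynomialX (Fin m) (Fin m) ℂ) with hL
  have hLab : ∀ a b, L a b = linSubst (Fin m × Fin m) ℂ g (MvPolynomial.X (a, b)) := fun a b => by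
    simp only [hL, RingHom.mapMatrix_apply, Matrix.map_apply, Matrix.mvPolynomialX_apply]; rfl
  have hdet : linSubst (Fin m × Fin m) ℂ g (detPoly (Fin m) ℂ) = L.det := by
    rw [hL, detPoly, ← RingHom.map_det]; rfl
  have hlin : ∀ a b, (L a b).IsHomogeneous 1 := fun a b => by
    rw [hLab]; exact linSubst_isHomogeneous g (MvPolynomial.isHomogeneous_X ℂ (a, b))
  have hfeasL : ∀ a b j, p a + q b < j → MvPolynomial.weightedHomogeneousComponent w j (L a b) = 0 :=
    fun a b j hj => by rw [hLab]; exact hfeas a b j hj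
  -- `Σp + Σq ≤ e`: the tight determinant is the (nonzero) slice of weight `Σp + Σq`
  have hTe : ∑ a, p a + ∑ b, q b ≤ e := by
    have hslice : MvPolynomial.weightedHomogeneousComponent w (∑ a, p a + ∑ b, q b) L.det ≠ 0 := by
      rw [weightedHomogeneousComponent_det_eq_det_tight L hlin w p q hfeasL]
      simp only [hLab]
      exact htight
    obtain ⟨d, hd⟩ := MvPolynomial.ne_zero_iff.mp hslice
    rw [MvPolynomial.coeff_weightedHomogeneousComponent] at hd
    split_ifs at hd with hwd
    · have hmem : d ∈ (linSubst (Fin m × Fin m) ℂ g (detPoly (Fin m) ℂ)).support := by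
        rw [hdet]; exact MvPolynomial.mem_support_iff.mpr hd
      exact hwd ▸ hext d hmem
    · exact absurd rfl hd
  -- `e ≤ Σp + Σq`: otherwise the slice vanishes
  have heT : e ≤ ∑ a, p a + ∑ b, q b := by
    refine le_of_not_gt fun hlt => hne ?_
    rw [hdet]
    exact weightedHomogeneousComponent_det_eq_zero_of_lt L hlin w p q hfeasL hlt
  exact le_antisymm hTe heT

/-- **Nonsingular tight matrix ⇒ the extremal slice de-borders for free** (per/det-blind): under the hypotheses of
`sum_potentials_eq_of_det_tight_ne_zero`, every translate `u · wHC_w^e (g · det_m)` of the extremal slice is an honest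
`m × m` determinant of linear forms (`hasDetRepr_slice_of_tight_potentials`). [folklore] -/
theorem hasDetRepr_slice_of_det_tight_ne_zero {m : ℕ}
    (u g : Matrix (Fin m × Fin m) (Fin m × Fin m) ℂ) (w : Fin m × Fin m → ℕ) (e : ℕ) (p q : Fin m → ℕ)
    (hfeas : ∀ a b j, p a + q b < j →
      MvPolynomial.weightedHomogeneousComponent w j (linSubst (Fin m × Fin m) ℂ g (MvPolynomial.X (a, b))) = 0)
    (htight : (Matrix.of fun a b => MvPolynomial.weightedHomogeneousComponent w (p a + q b)
      (linSubst (Fin m × Fin m) ℂ g (MvPolynomial.X (a, b)))).det ≠ 0)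
    (hext : ∀ d ∈ (linSubst (Fin m × Fin m) ℂ g (detPoly (Fin m) ℂ)).support, Finsupp.weight w d ≤ e)
    (hne : MvPolynomial.weightedHomogeneousComponent w e (linSubst (Fin m × Fin m) ℂ g (detPoly (Fin m) ℂ)) ≠ 0) :
    HasDetRepr (linSubst (Fin m × Fin m) ℂ u
      (MvPolynomial.weightedHomogeneousComponent w e (linSubst (Fin m × Fin m) ℂ g (detPoly (Fin m) ℂ)))) m :=
  hasDetRepr_slice_of_tight_potentials u g w e p q hfeas
    (sum_potentials_eq_of_det_tight_ne_zero g w e p q hfeas htight hext hne)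

/-- **Nonsingular tight matrix ⇒ the extremal initial form stays in `End · det_m`** (per/det-blind, geometric form):
under the hypotheses of `sum_potentials_eq_of_det_tight_ne_zero`, every translate `u · wHC_w^e (g · det_m)` of the nonzero
extremal slice is a linear-substitution instance of `det_m` — the determinant of the tight matrix of linear forms
(`weightedHomogeneousComponent_det_eq_det_tight`, `det_mem_endOrbit_detPoly`).  Such toric limits never reach the part
`Δ(det_m) ∖ End · det_m` of the boundary. [folklore] -/
theorem linSubst_slice_mem_endOrbit_of_det_tight_ne_zero {m : ℕ}
    (u g : Matrix (Fin m × Fin m) (Fin m × Fin m) ℂ) (w : Fin m × Fin m → ℕ) (e : ℕ) (p q : Fin m → ℕ)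
    (hfeas : ∀ a b j, p a + q b < j →
      MvPolynomial.weightedHomogeneousComponent w j (linSubst (Fin m × Fin m) ℂ g (MvPolynomial.X (a, b))) = 0)
    (htight : (Matrix.of fun a b => MvPolynomial.weightedHomogeneousComponent w (p a + q b)
      (linSubst (Fin m × Fin m) ℂ g (MvPolynomial.X (a, b)))).det ≠ 0)
    (hext : ∀ d ∈ (linSubst (Fin m × Fin m) ℂ g (detPoly (Fin m) ℂ)).support, Finsupp.weight w d ≤ e)
    (hne : MvPolynomial.weightedHomogeneousComponent w e (linSubst (Fin m × Fin m) ℂ g (detPoly (Fin m) ℂ)) ≠ 0) :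
    linSubst (Fin m × Fin m) ℂ u
      (MvPolynomial.weightedHomogeneousComponent w e (linSubst (Fin m × Fin m) ℂ g (detPoly (Fin m) ℂ))) ∈
      endOrbit (Fin m × Fin m) ℂ (detPoly (Fin m) ℂ) := by
  have heq := sum_potentials_eq_of_det_tight_ne_zero g w e p q hfeas htight hext hne
  set L : Matrix (Fin m) (Fin m) (MvPolynomial (Fin m × Fin m) ℂ) :=
    (linSubst (Fin m × Fin m) ℂ g).toRingHom.mapMatrix (Matrix.mvPolynomialX (Fin m) (Fin m) ℂ) with hL
  have hLab : ∀ a b, L a b = linSubst (Fin m × Fin m) ℂ g (MvPolynomial.X (a, b)) := fun a b => by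
    simp only [hL, RingHom.mapMatrix_apply, Matrix.map_apply, Matrix.mvPolynomialX_apply]; rfl
  have hdet : linSubst (Fin m × Fin m) ℂ g (detPoly (Fin m) ℂ) = L.det := by
    rw [hL, detPoly, ← RingHom.map_det]; rfl
  have hlin : ∀ a b, (L a b).IsHomogeneous 1 := fun a b => by
    rw [hLab]; exact linSubst_isHomogeneous g (MvPolynomial.isHomogeneous_X ℂ (a, b))
  have hfeasL : ∀ a b j, p a + q b < j → MvPolynomial.weightedHomogeneousComponent w j (L a b) = 0 :=
    fun a b j hj => by rw [hLab]; exact hfeas a b j hj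
  -- the slice is the tight determinant, a determinant of linear forms; so is its translate by `u`
  rw [hdet, ← heq, weightedHomogeneousComponent_det_eq_det_tight L hlin w p q hfeasL, AlgHom.map_det]
  refine det_mem_endOrbit_detPoly _ fun a b => ?_
  simp only [AlgHom.mapMatrix_apply, Matrix.map_apply, Matrix.of_apply]
  exact linSubst_isHomogeneous u (isHomogeneous_weightedHomogeneousComponent (hlin a b) w _)

/-- **Nonsingular tight matrix ⇒ `dc(per_n) ≤ m`.**  If `pp_{n,m} = u · wHC_w^e (g · det_m)` is an EXTREMAL toric
representation of the padded permanent and feasible potentials for the entries of `g · x` have a nonsingular tight matrix,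
then `e = Σp + Σq` (the slice is nonzero because `pp ≠ 0`) and `per_n` is an honest `m × m` determinant
(`hasDetRepr_of_tight_potentials`). [folklore] -/
theorem sum_potentials_eq_and_hasDetRepr_of_det_tight_ne_zero {n m : ℕ} [NeZero m] (hnm : n ≤ m)
    (u g : Matrix (Fin m × Fin m) (Fin m × Fin m) ℂ) (w : Fin m × Fin m → ℕ) (e : ℕ) (p q : Fin m → ℕ)
    (hfeas : ∀ a b j, p a + q b < j →
      MvPolynomial.weightedHomogeneousComponent w j (linSubst (Fin m × Fin m) ℂ g (MvPolynomial.X (a, b))) = 0)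
    (htight : (Matrix.of fun a b => MvPolynomial.weightedHomogeneousComponent w (p a + q b)
      (linSubst (Fin m × Fin m) ℂ g (MvPolynomial.X (a, b)))).det ≠ 0)
    (hext : ∀ d ∈ (linSubst (Fin m × Fin m) ℂ g (detPoly (Fin m) ℂ)).support, Finsupp.weight w d ≤ e)
    (hpp : paddedPerPoly ℂ n m = linSubst (Fin m × Fin m) ℂ u
      (MvPolynomial.weightedHomogeneousComponent w e (linSubst (Fin m × Fin m) ℂ g (detPoly (Fin m) ℂ)))) :
    ∑ a, p a + ∑ b, q b = e ∧ HasDetRepr (perPoly (Fin n) ℂ) m := by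
  have hne : MvPolynomial.weightedHomogeneousComponent w e
      (linSubst (Fin m × Fin m) ℂ g (detPoly (Fin m) ℂ)) ≠ 0 := fun hzero => by
    rw [hzero, map_zero] at hpp
    exact Literature.Computability.AlgebraicComplexity.BorderApolarity.paddedPerPoly_ne_zero n m hpp
  have heq := sum_potentials_eq_of_det_tight_ne_zero g w e p q hfeas htight hext hne
  exact ⟨heq, hasDetRepr_of_tight_potentials hnm u g w e p q hfeas heq hpp⟩

/-- **Homogeneous entries have a nonsingular Egerváry-tight matrix.**  If `g` is invertible and every entry
`g · x_ab` is `w`-homogeneous of weight `ν a b`, then for any potentials `p, q` with a TIGHT permutation `σ`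
(`p a + q (σ a) = ν a (σ a)`, Egerváry) the tight matrix `(wHC_w^{p_a+q_b} (g · x_ab))_ab` is nonsingular: evaluated at
the `g`-preimage of the permutation matrix of `σ` (the entries of `g · x` are linearly independent forms) it IS that
permutation matrix, of determinant `sign σ ≠ 0`. [folklore] -/
theorem det_tight_ne_zero_of_isWeightedHomogeneous {m : ℕ}
    (g : Matrix (Fin m × Fin m) (Fin m × Fin m) ℂ) (hg : IsUnit g.det) (w : Fin m × Fin m → ℕ)
    (ν : Fin m → Fin m → ℕ)
    (hhom : ∀ a b, MvPolynomial.IsWeightedHomogeneous w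
      (linSubst (Fin m × Fin m) ℂ g (MvPolynomial.X (a, b))) (ν a b))
    (p q : Fin m → ℕ) (σ : Equiv.Perm (Fin m)) (hσ : ∀ a, p a + q (σ a) = ν a (σ a)) :
    (Matrix.of fun a b => MvPolynomial.weightedHomogeneousComponent w (p a + q b)
      (linSubst (Fin m × Fin m) ℂ g (MvPolynomial.X (a, b)))).det ≠ 0 := by
  classical
  -- the point `x₀` with `(g · x_ab)(x₀) = [σ a = b]`
  set v : Fin m × Fin m → ℂ := fun i => if σ i.1 = i.2 then 1 else 0 with hv
  set x₀ : Fin m × Fin m → ℂ := Matrix.vecMul v g⁻¹ with hx₀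
  have heval : ∀ i, MvPolynomial.eval x₀ (linSubst (Fin m × Fin m) ℂ g (MvPolynomial.X i)) = v i := by
    intro i
    rw [linSubst_X, map_sum]
    simp only [MvPolynomial.smul_eval, MvPolynomial.eval_X]
    have hsum : ∑ j, g j i * x₀ j = Matrix.vecMul x₀ g i := by
      simp only [Matrix.vecMul, dotProduct]
      exact Finset.sum_congr rfl fun j _ => mul_comm _ _
    rw [hsum, hx₀, Matrix.vecMul_vecMul, Matrix.nonsing_inv_mul _ hg, Matrix.vecMul_one]
  intro hdet0
  have h := congrArg (MvPolynomial.eval x₀) hdet0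
  rw [map_zero, RingHom.map_det] at h
  have hM : (MvPolynomial.eval x₀).mapMatrix (Matrix.of fun a b =>
      MvPolynomial.weightedHomogeneousComponent w (p a + q b)
        (linSubst (Fin m × Fin m) ℂ g (MvPolynomial.X (a, b)))) = σ.permMatrix ℂ := by
    ext a b
    simp only [RingHom.mapMatrix_apply, Matrix.map_apply, Matrix.of_apply, Equiv.Perm.permMatrix,
      PEquiv.toMatrix_apply, Equiv.toPEquiv_apply, Option.mem_def, Option.some.injEq]
    rw [MvPolynomial.weightedHomogeneousComponent_of_mem
      ((MvPolynomial.mem_weightedHomogeneousSubmodule ℂ w (ν a b) _).mpr (hhom a b))]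
    split_ifs with h1 h2 h2
    · rw [heval]; simp only [hv]; rw [if_pos h2]
    · rw [heval]; simp only [hv]; rw [if_neg h2]
    · exfalso; apply h1; rw [← h2]; exact hσ a
    · exact map_zero _
  rw [hM, Matrix.det_permutation] at h
  exact (Int.cast_ne_zero.mpr (Units.ne_zero (Equiv.Perm.sign σ))) h

/-- **Homogeneous frames de-border for free.**  If `pp_{n,m} = u · wHC_w^e (g · det_m)` is an EXTREMAL toric
representation of the padded permanent whose frame `g` is invertible with every entry `g · x_ab` `w`-homogeneous
(e.g. every monomial `g`: tori normalised by the matrix frame), then `per_n` is an honest `m × m` determinant.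
Proof: Egerváry's duality theorem (`EgervaryDuality_holds`) supplies feasible potentials with a tight permutation for the
entry weights; the tight matrix is nonsingular (`det_tight_ne_zero_of_isWeightedHomogeneous`); conclude by
`sum_potentials_eq_and_hasDetRepr_of_det_tight_ne_zero`. [folklore] -/
theorem hasDetRepr_perPoly_of_homogeneousFrame {n m : ℕ} [NeZero m] (hnm : n ≤ m)
    (u g : Matrix (Fin m × Fin m) (Fin m × Fin m) ℂ) (hg : IsUnit g.det) (w : Fin m × Fin m → ℕ) (e : ℕ)
    (ν : Fin m → Fin m → ℕ)
    (hhom : ∀ a b, MvPolynomial.IsWeightedHomogeneous w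
      (linSubst (Fin m × Fin m) ℂ g (MvPolynomial.X (a, b))) (ν a b))
    (hext : ∀ d ∈ (linSubst (Fin m × Fin m) ℂ g (detPoly (Fin m) ℂ)).support, Finsupp.weight w d ≤ e)
    (hpp : paddedPerPoly ℂ n m = linSubst (Fin m × Fin m) ℂ u
      (MvPolynomial.weightedHomogeneousComponent w e (linSubst (Fin m × Fin m) ℂ g (detPoly (Fin m) ℂ)))) :
    HasDetRepr (perPoly (Fin n) ℂ) m := by
  obtain ⟨p, q, σ, hfeasν, hσ⟩ := Literature.Combinatorics.Optimization.EgervaryDuality_holds (Fin m) ν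
  have hfeas : ∀ a b j, p a + q b < j →
      MvPolynomial.weightedHomogeneousComponent w j (linSubst (Fin m × Fin m) ℂ g (MvPolynomial.X (a, b))) = 0 :=
    fun a b j hj => (hhom a b).weightedHomogeneousComponent_ne j (by have := hfeasν a b; omega)
  exact (sum_potentials_eq_and_hasDetRepr_of_det_tight_ne_zero hnm u g w e p q hfeas
    (det_tight_ne_zero_of_isWeightedHomogeneous g hg w ν hhom p q σ hσ) hext hpp).2

/-- **Frame-compatible toric limits of `det_m` stay in `End · det_m`** (per/det-blind, geometric form).  If `g` is
invertible with every entry `g · x_ab` `w`-homogeneous, then every nonzero EXTREMAL slice `wHC_w^e (g · det_m)` — the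
`w`-initial form, i.e. the torus limit `lim_t t^{-e} (g · det_m)(t^w x)` — and all its translates `u · (…)` are
linear-substitution instances of `det_m`.  So one-parameter tori compatible with the matrix frame never degenerate the
determinant out of its endomorphism orbit; the GCT-relevant boundary `Δ(det_m) ∖ End · det_m` needs weight-mixing frames.
[folklore] -/
theorem linSubst_initialForm_mem_endOrbit_of_homogeneousFrame {m : ℕ}
    (u g : Matrix (Fin m × Fin m) (Fin m × Fin m) ℂ) (hg : IsUnit g.det) (w : Fin m × Fin m → ℕ) (e : ℕ)
    (ν : Fin m → Fin m → ℕ)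
    (hhom : ∀ a b, MvPolynomial.IsWeightedHomogeneous w
      (linSubst (Fin m × Fin m) ℂ g (MvPolynomial.X (a, b))) (ν a b))
    (hext : ∀ d ∈ (linSubst (Fin m × Fin m) ℂ g (detPoly (Fin m) ℂ)).support, Finsupp.weight w d ≤ e)
    (hne : MvPolynomial.weightedHomogeneousComponent w e (linSubst (Fin m × Fin m) ℂ g (detPoly (Fin m) ℂ)) ≠ 0) :
    linSubst (Fin m × Fin m) ℂ u
      (MvPolynomial.weightedHomogeneousComponent w e (linSubst (Fin m × Fin m) ℂ g (detPoly (Fin m) ℂ))) ∈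
      endOrbit (Fin m × Fin m) ℂ (detPoly (Fin m) ℂ) := by
  obtain ⟨p, q, σ, hfeasν, hσ⟩ := Literature.Combinatorics.Optimization.EgervaryDuality_holds (Fin m) ν
  have hfeas : ∀ a b j, p a + q b < j →
      MvPolynomial.weightedHomogeneousComponent w j (linSubst (Fin m × Fin m) ℂ g (MvPolynomial.X (a, b))) = 0 :=
    fun a b j hj => (hhom a b).weightedHomogeneousComponent_ne j (by have := hfeasν a b; omega)
  exact linSubst_slice_mem_endOrbit_of_det_tight_ne_zero u g w e p q hfeas
    (det_tight_ne_zero_of_isWeightedHomogeneous g hg w ν hhom p q σ hσ) hext hne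

/-- **`ToricDeborderQP` holds, with the LINEAR bound `dc(per_n) ≤ m`, on homogeneous-entry frames** (the hypothesis
shape of the registered stub `stub_toricDeborderQP`, `u g ∈ GL_{m²}`, plus homogeneity of the entries of `g · x`):
such extremal toric representations never undercut the determinantal complexity of the permanent. [folklore] -/
theorem determinantalComplexity_perPoly_le_of_homogeneousFrame (n m : ℕ) [NeZero m] (hnm : n ≤ m)
    (u g : Matrix.GeneralLinearGroup (Fin m × Fin m) ℂ) (w : Fin m × Fin m → ℕ) (e : ℕ)
    (hhom : ∀ a b, ∃ ν : ℕ, MvPolynomial.IsWeightedHomogeneous w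
      (linSubst (Fin m × Fin m) ℂ (g : Matrix (Fin m × Fin m) (Fin m × Fin m) ℂ) (MvPolynomial.X (a, b))) ν)
    (hext : ∀ d ∈ (linSubst (Fin m × Fin m) ℂ (g : Matrix (Fin m × Fin m) (Fin m × Fin m) ℂ)
      (detPoly (Fin m) ℂ)).support, Finsupp.weight w d ≤ e)
    (hpp : paddedPerPoly ℂ n m =
      linSubst (Fin m × Fin m) ℂ (u : Matrix (Fin m × Fin m) (Fin m × Fin m) ℂ)
        (MvPolynomial.weightedHomogeneousComponent w e
          (linSubst (Fin m × Fin m) ℂ (g : Matrix (Fin m × Fin m) (Fin m × Fin m) ℂ) (detPoly (Fin m) ℂ)))) :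
    determinantalComplexity (perPoly (Fin n) ℂ) ≤ m := by
  choose ν hν using hhom
  have hg : IsUnit (g : Matrix (Fin m × Fin m) (Fin m × Fin m) ℂ).det :=
    (Matrix.isUnit_iff_isUnit_det _).mp (Units.isUnit g)
  exact determinantalComplexity_le_of_hasDetRepr
    (hasDetRepr_perPoly_of_homogeneousFrame hnm _ _ hg w e ν hν hext hpp)

/-- **Registered stub `stub_homogeneousFrame` of crux stmt-5778 (line `toric-face-debordering`, seat c3): the
homogeneous-frame case of `ToricDeborderQP`, verbatim signature** — an extremal toric representation of the padded
permanent at size `m` in a frame `g ∈ GL_{m²}` all of whose entries `g · x_ab` are `w`-homogeneous forces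
`dc(per_n) ≤ m` (`determinantalComplexity_perPoly_le_of_homogeneousFrame`). [folklore] -/
theorem stub_homogeneousFrame : ∀ (n m : ℕ) [NeZero m], n ≤ m → ∀ (u g : Matrix.GeneralLinearGroup (Fin m × Fin m) ℂ) (w : Fin m × Fin m → ℕ) (e : ℕ), (∀ a b : Fin m, ∃ ν : ℕ, MvPolynomial.IsWeightedHomogeneous w (Literature.Computability.AlgebraicComplexity.linSubst (Fin m × Fin m) ℂ (g : Matrix (Fin m × Fin m) (Fin m × Fin m) ℂ) (MvPolynomial.X (a, b))) ν) → (∀ d ∈ (Literature.Computability.AlgebraicComplexity.linSubst (Fin m × Fin m) ℂ (g : Matrix (Fin m × Fin m) (Fin m × Fin m) ℂ) (Literature.Computability.AlgebraicComplexity.detPoly (Fin m) ℂ)).support, Finsupp.weight w d ≤ e) → Literature.Computability.AlgebraicComplexity.paddedPerPoly ℂ n m = Literature.Computability.AlgebraicComplexity.linSubst (Fin m × Fin m) ℂ (u : Matrix (Fin m × Fin m) (Fin m × Fin m) ℂ) (MvPolynomial.weightedHomogeneousComponent w e (Literature.Computability.AlgebraicComplexity.linSubst (Fin m × Fin m) ℂ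 (g : Matrix (Fin m × Fin m) (Fin m × Fin m) ℂ) (Literature.Computability.AlgebraicComplexity.detPoly (Fin m) ℂ))) → Literature.Computability.AlgebraicComplexity.determinantalComplexity (Literature.Computability.AlgebraicComplexity.perPoly (Fin n) ℂ) ≤ m :=
  fun n m _ hnm u g w e hhom hext hpp =>
    determinantalComplexity_perPoly_le_of_homogeneousFrame n m hnm u g w e hhom hext hpp

/-- A MONOMIAL frame `g = P · diag(c)` sends each variable to a scaled variable, `g · x_i = c_i • x_{P⁻¹ i}`, which is
`w`-homogeneous of weight `w (P⁻¹ i)`. [folklore] -/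
theorem isWeightedHomogeneous_linSubst_monomialFrame_X {σ : Type*} [Fintype σ] [DecidableEq σ]
    (P : Equiv.Perm σ) (c : σ → ℂ) (w : σ → ℕ) (i : σ) :
    MvPolynomial.IsWeightedHomogeneous w
      (linSubst σ ℂ (P.permMatrix ℂ * Matrix.diagonal c) (MvPolynomial.X i)) (w (P.symm i)) := by
  rw [linSubst_mul, AlgHom.comp_apply, linSubst_diagonal_X, map_smul, linSubst_permMatrix,
    MvPolynomial.rename_X]
  exact (MvPolynomial.mem_weightedHomogeneousSubmodule ℂ w _ _).mp
    (Submodule.smul_mem _ _ ((MvPolynomial.mem_weightedHomogeneousSubmodule ℂ w _ _).mpr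
      (MvPolynomial.isWeightedHomogeneous_X ℂ w (P.symm i))))

/-- **Monomial frames** (tori normalised by the matrix frame: `g = P · diag(c)`, `P` a permutation of the `m²` variables,
`c` nowhere zero): an extremal toric representation `pp_{n,m} = u · in_w(g · det_m)` forces `dc(per_n) ≤ m`. [folklore] -/
theorem determinantalComplexity_perPoly_le_of_monomialFrame (n m : ℕ) [NeZero m] (hnm : n ≤ m)
    (u : Matrix (Fin m × Fin m) (Fin m × Fin m) ℂ) (P : Equiv.Perm (Fin m × Fin m)) (c : Fin m × Fin m → ℂ)
    (hc : ∀ i, c i ≠ 0) (w : Fin m × Fin m → ℕ) (e : ℕ)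
    (hext : ∀ d ∈ (linSubst (Fin m × Fin m) ℂ (P.permMatrix ℂ * Matrix.diagonal c) (detPoly (Fin m) ℂ)).support,
      Finsupp.weight w d ≤ e)
    (hpp : paddedPerPoly ℂ n m = linSubst (Fin m × Fin m) ℂ u
      (MvPolynomial.weightedHomogeneousComponent w e
        (linSubst (Fin m × Fin m) ℂ (P.permMatrix ℂ * Matrix.diagonal c) (detPoly (Fin m) ℂ)))) :
    determinantalComplexity (perPoly (Fin n) ℂ) ≤ m := by
  have hg : IsUnit (P.permMatrix ℂ * Matrix.diagonal c).det := by
    rw [Matrix.det_mul, Matrix.det_permutation, Matrix.det_diagonal]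
    exact (IsUnit.mk0 _ (Int.cast_ne_zero.mpr (Units.ne_zero (Equiv.Perm.sign P)))).mul
      (IsUnit.mk0 _ (Finset.prod_ne_zero_iff.mpr fun i _ => hc i))
  exact determinantalComplexity_le_of_hasDetRepr
    (hasDetRepr_perPoly_of_homogeneousFrame hnm u _ hg w e (fun a b => w (P.symm (a, b)))
      (fun a b => isWeightedHomogeneous_linSubst_monomialFrame_X P c w (a, b)) hext hpp)

end Summit.ValiantsHypothesis.ValiantsHypothesis.Theorems.BorderApolarityFixedWitnessObstructionQP
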